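import Literature.Analysis.FluidPDE.TorusLinearisedNSH2Balance
import Literature.Analysis.FluidPDE.TorusClassicalH3Balance
import Literature.Analysis.FunctionSpaces.TorusConvectionLaplacianNormSqBilinear
import HarnessLib

/-!
# The `H³` balance of the linearised Navier–Stokes equation along a smooth field on the torus,
# and its flux bound on `T³`

Analysis/FluidPDE proof file (theorems only; no definitions, no named facts), the `H³` sequel of
`TorusLinearisedNSH2Balance.lean` (the `H²` balance of the first variation equation and its flux
bound) and the LINEAR twin of `TorusClassicalH3Balance.lean` (the odd-order balances
`d/dt ½‖∇Δⁿu‖₂²` of the nonlinear system and the flux bound of its `H³` balance). For a jointly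
smooth solution `(w, q)` of the linearised Navier–Stokes equation
`∂ₜw + (u·∇)w + (w·∇)u = νΔw − ∇q`, `div w = 0`, along a jointly smooth field `u` on `[a, b] × T^d`
(Constantin–Foias 1988, Ch. 14, (14.3); clauses as separate hypotheses, no predicate):

* `Torus.linearisedNS_hasDerivWithinAt_half_gradNormSq_laplacian_iterate` — the ODD-ORDER BALANCES
  `d/dt ½‖∇Δⁿw‖₂² = −ν‖Δⁿ⁺¹w‖₂² + ∫ ⟪(u·∇)w + (w·∇)u, Δ²ⁿ⁺¹w⟫` within `[a, b]` (differentiate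
  `½ ∫ ∑ᵢ ‖∂ᵢΔⁿw‖²` under the integral, `∂ₜ∂ᵢΔⁿ = ∂ᵢΔⁿ∂ₜ`, Green twice, insert the equation, drop
  the pressure because `Δ²ⁿ⁺¹w` is divergence free; incompressibility of `u` is not needed) — "the
  inner product of the first variation equation with `A^{2n+1}U`" (Foias–Manley–Rosa–Temam 2001,
  App. II.A (A.55) and Ch. II §7, for the nonlinear system); the case `n = 1`,
  `d/dt ½‖∇Δw‖₂² = −ν‖ΔΔw‖₂² + ∫ ⟪(u·∇)w + (w·∇)u, ΔΔΔw⟫`, is spelled out without iterates as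
  `Torus.linearisedNS_hasDerivWithinAt_half_gradNormSq_laplacian`;
* `Torus.neg_mul_integral_norm_laplacian_laplacian_sq_add_le` — Young for the `H³` flux in every
  dimension, the production term `F` left symbolic:
  `−ν‖ΔΔw‖₂² + ∫ ⟪F, ΔΔΔw⟫ ≤ −(ν/2)‖ΔΔw‖₂² + ν⁻¹‖ΔF‖₂²` (move one Laplacian across, Green's second
  identity, then `|∫ ⟪ΔF, ΔΔw⟫| ≤ ν⁻¹‖ΔF‖₂² + (ν/4)‖ΔΔw‖₂²`);
* `Torus.linearisedNS_gradNormSq_laplacian_flux_le` — the FLUX BOUND of the `H³` balance of the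
  linearised equation on `T³`, combining the previous item with the bilinear `H²` product bound
  `‖Δ((v·∇)w + (w·∇)v)‖₂² ≤ C (M² + L² + ‖Δv‖₂² + ‖∇Δv‖₂²)(‖∇w‖₂² + ‖Δw‖₂² + ‖∇Δw‖₂²)` of
  `FunctionSpaces/TorusConvectionLaplacianNormSqBilinear.lean` (zero-mean `w`, `‖v‖ ≤ M`, `‖∂ₖv‖ ≤ L`;
  "`B` maps `D(A^{3/2}) × D(A^{3/2})` into `D(A)`", Constantin–Foias 1988, Ch. 6):
  `−ν‖ΔΔw‖₂² + ∫ ⟪(v·∇)w + (w·∇)v, ΔΔΔw⟫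
     ≤ −(ν/2)‖ΔΔw‖₂² + ν⁻¹ C (M² + L² + ‖Δv‖₂² + ‖∇Δv‖₂²)(‖∇w‖₂² + ‖Δw‖₂² + ‖∇Δw‖₂²)`,
  the linearised form of the `k = 3` differential inequality (7.3) of Robinson–Rodrigo–Sadowski 2016,
  LINEAR in the top-order quantity `‖∇Δw‖₂²` once `v` is controlled in `W^{1,∞} ∩ H³`.

Consumed by the `V → D(A^{3/2})` smoothing estimate of the linearised flow
(`TorusLinearisedNSH3Smoothing.lean`). Deliberately NOT here: forces, the even orders beyond
`TorusLinearisedNSH2Balance`, backward estimates.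

## Mathlib / tree search

Tree (reused): `Torus.IsSmoothSpaceTimeOn.laplacian_iterate`, `Torus.timeDerivWithin_laplacian_iterate_comm`,
`Torus.timeDerivWithin_partialDeriv_comm`, `Torus.isSmooth_laplacian_iterate`,
`Torus.sum_integral_inner_partialDeriv_eq_neg_integral_inner_laplacian`,
`Torus.IsDivFree.laplacian_iterate_of_isSmooth`, `Torus.integral_inner_laplacian_iterate_comm`,
`Torus.integral_inner_laplacian_comm`, `Torus.integral_inner_gradient_eq_zero_of_isDivFree`,
`Torus.abs_integral_inner_le_integral_norm_sq` (`TorusClassicalH3Balance` and its imports),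
`Torus.integral_norm_laplacian_convect_add_convect_sq_le` (`TorusConvectionLaplacianNormSqBilinear`); the patterns are
`Torus.IsClassicalNSSolutionOn.hasDerivWithinAt_half_gradNormSq_laplacian_iterate`,
`….gradNormSq_laplacian_flux_le` (`TorusClassicalH3Balance`). Searched `linearisedNS.*gradNormSq_laplacian`,
`LinearisedNSH3`, `half_gradNormSq_laplacian` for the linearised equation: nothing (the module docstring of
`TorusLinearisedNSH2Balance` lists the `H³` level as not treated).

## References

* C. Foias, O. Manley, R. Rosa, R. Temam, *Navier–Stokes Equations and Turbulence*, CUP 2001,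
  Ch. II App. A (A.55) and §7. [FoiasManleyRosaTemam2001]
* P. Constantin, C. Foias, *Navier–Stokes Equations*, Univ. Chicago Press 1988, Ch. 6, Ch. 14
  (14.2)–(14.4). [ConstantinFoiasNSE1988]
* J. C. Robinson, J. L. Rodrigo, W. Sadowski, *The Three-Dimensional Navier–Stokes Equations*,
  CUP 2016, Thm 7.1 (7.3). [RobinsonRodrigoSadowskiCUP2016]
-/

noncomputable section

open MeasureTheory Set Function Filter
open scoped ContDiff InnerProductSpace RealInnerProductSpace Topology

namespace Literature.Analysis.FluidPDE

open Literature.Analysis.FunctionSpaces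

variable {d : Type*} [Fintype d] [DecidableEq d]

/-! ### The odd-order balances of the linearised equation -/

/-- **The odd-order Sobolev balances of the linearised Navier–Stokes equation on the torus.** Let
`u` be jointly smooth on `[a, b] × T^d` (`a < b`) and let `(w, q)` be jointly smooth with
`div w(t) = 0` and `∂ₜw + (u·∇)w + (w·∇)u = νΔw − ∇q` pointwise on `[a, b] × T^d` (one-sided time
derivative within `[a, b]`). Then for every `n : ℕ` and every `t ∈ [a, b]`,
`d/dt ½‖∇Δⁿw(t)‖₂² = −ν ∫ ‖Δⁿ⁺¹w(t)‖² + ∫ ⟪(u·∇)w(t) + (w·∇)u(t), Δ²ⁿ⁺¹w(t)⟫`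
as a one-sided derivative within `[a, b]` — "the inner product of the first variation equation
with `A^{2n+1}U`" (the computation of Foias–Manley–Rosa–Temam 2001, App. II.A (A.55) / §7, for the
linearised system (14.3) of Constantin–Foias 1988): differentiate `½ ∫ ∑ᵢ ‖∂ᵢΔⁿw‖²` under the
integral, `∂ₜ∂ᵢΔⁿ = ∂ᵢΔⁿ∂ₜ`, Green twice (`∑ᵢ ∫ ⟪∂ᵢΔⁿ∂ₜw, ∂ᵢΔⁿw⟫ = −∫ ⟪∂ₜw, Δ²ⁿ⁺¹w⟫`), insert
the equation, use `∫ ⟪Δw, Δ²ⁿ⁺¹w⟫ = ‖Δⁿ⁺¹w‖₂²` and drop `∫ ⟪∇q, Δ²ⁿ⁺¹w⟫ = 0` (`Δ²ⁿ⁺¹w` is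
divergence free). Incompressibility of `u` is not needed.
[cite: FoiasManleyRosaTemam2001, App. II.A (A.55) and Ch. II §7] -/
theorem Torus.linearisedNS_hasDerivWithinAt_half_gradNormSq_laplacian_iterate
    {a b ν : ℝ} {u w : ℝ → UnitAddTorus d → EuclideanSpace ℝ d} {q : ℝ → UnitAddTorus d → ℝ}
    (hu : Torus.IsSmoothSpaceTimeOn (Icc a b) u) (hw : Torus.IsSmoothSpaceTimeOn (Icc a b) w)
    (hq : Torus.IsSmoothSpaceTimeOn (Icc a b) q) (hwdiv : ∀ t ∈ Icc a b, Torus.IsDivFree (w t))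
    (hlin : ∀ t ∈ Icc a b, ∀ x, Torus.timeDerivWithin (Icc a b) w t x +
      Torus.convect (u t) (w t) x + Torus.convect (w t) (u t) x =
        ν • Torus.laplacian (w t) x - Torus.gradient (q t) x)
    (hab : a < b) (n : ℕ) {t : ℝ} (ht : t ∈ Icc a b) :
    HasDerivWithinAt (fun s => 2⁻¹ * Torus.gradNormSq (Torus.laplacian^[n] (w s)))
      (-ν * (∫ x, ‖(Torus.laplacian^[n + 1] (w t)) x‖ ^ 2) +
        ∫ x, ⟪Torus.convect (u t) (w t) x + Torus.convect (w t) (u t) x,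
          (Torus.laplacian^[2 * n + 1] (w t)) x⟫) (Icc a b) t := by
  set S : Set ℝ := Icc a b with hSdef
  have hSc : Convex ℝ S := convex_Icc a b
  have hU : UniqueDiffOn ℝ S := uniqueDiffOn_Icc hab
  have hwt : Torus.IsSmooth (w t) := hw.isSmooth_slice ht
  have hut : Torus.IsSmooth (u t) := hu.isSmooth_slice ht
  have hqt : Torus.IsSmooth (q t) := hq.isSmooth_slice ht
  have hA : Torus.IsSmooth (Torus.timeDerivWithin S w t) := hw.isSmooth_timeDerivWithin hU ht
  have hΔ : Torus.IsSmooth (Torus.laplacian (w t)) := hwt.laplacian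
  have hW : Torus.IsSmoothSpaceTimeOn S (fun s => Torus.laplacian^[n] (w s)) := hw.laplacian_iterate hU n
  have hWt : Torus.IsSmooth (Torus.laplacian^[n] (w t)) := Torus.isSmooth_laplacian_iterate hwt n
  have hnA : Torus.IsSmooth (Torus.laplacian^[n] (Torus.timeDerivWithin S w t)) :=
    Torus.isSmooth_laplacian_iterate hA n
  have hZ : Torus.IsSmooth (Torus.laplacian^[2 * n + 1] (w t)) :=
    Torus.isSmooth_laplacian_iterate hwt (2 * n + 1)
  have hDi : ∀ i, Torus.IsSmoothSpaceTimeOn S (fun s => Torus.partialDeriv i (Torus.laplacian^[n] (w s))) :=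
    fun i => hW.partialDeriv hU i
  -- iterate bookkeeping
  have h2n1 : ∀ v : UnitAddTorus d → EuclideanSpace ℝ d,
      Torus.laplacian^[n] (Torus.laplacian (Torus.laplacian^[n] v)) = Torus.laplacian^[2 * n + 1] v := by
    intro v
    rw [← Function.iterate_succ_apply' Torus.laplacian n v, ← Function.iterate_add_apply]
    congr 1
    omega
  have hn1 : ∀ v : UnitAddTorus d → EuclideanSpace ℝ d,
      Torus.laplacian^[n] (Torus.laplacian v) = Torus.laplacian^[n + 1] v := fun v => by
    rw [Function.iterate_succ_apply]
  -- Step 1: differentiate `½ ∫ ∑ᵢ ‖∂ᵢΔⁿw‖²` under the integral sign.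
  have hφ : Torus.IsSmoothSpaceTimeOn S
      (fun s x => ∑ i, ‖Torus.partialDeriv i (Torus.laplacian^[n] (w s)) x‖ ^ 2) := by
    change ContDiffOn ℝ ∞
      (fun z => ∑ i, ‖Torus.stLift (fun s => Torus.partialDeriv i (Torus.laplacian^[n] (w s))) z‖ ^ 2)
      (S ×ˢ univ)
    exact ContDiffOn.sum fun i _ => (hDi i).norm_sq ℝ
  have hE : HasDerivWithinAt (fun s => 2⁻¹ * Torus.gradNormSq (Torus.laplacian^[n] (w s)))
      (2⁻¹ * ∫ x, Torus.timeDerivWithin S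
        (fun s x => ∑ i, ‖Torus.partialDeriv i (Torus.laplacian^[n] (w s)) x‖ ^ 2) t x) S t :=
    (hφ.hasDerivWithinAt_integral hSc ht).const_mul 2⁻¹
  -- Step 2: `∂ₜ ∑ᵢ ‖∂ᵢΔⁿw‖² = 2 ∑ᵢ ⟪∂ᵢΔⁿ∂ₜw, ∂ᵢΔⁿw⟫`.
  have hcomm : Torus.timeDerivWithin S (fun s => Torus.laplacian^[n] (w s)) t =
      Torus.laplacian^[n] (Torus.timeDerivWithin S w t) :=
    funext fun x => Torus.timeDerivWithin_laplacian_iterate_comm hab hw n ht x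
  have htd : ∀ x, Torus.timeDerivWithin S
      (fun s x => ∑ i, ‖Torus.partialDeriv i (Torus.laplacian^[n] (w s)) x‖ ^ 2) t x =
      2 * ∑ i, ⟪Torus.partialDeriv i (Torus.laplacian^[n] (Torus.timeDerivWithin S w t)) x,
        Torus.partialDeriv i (Torus.laplacian^[n] (w t)) x⟫ := by
    intro x
    have hsum := HasDerivWithinAt.fun_sum (u := Finset.univ)
      (A := fun i s => ‖Torus.partialDeriv i (Torus.laplacian^[n] (w s)) x‖ ^ 2)
      (A' := fun i => 2 * ⟪Torus.partialDeriv i (Torus.laplacian^[n] (w t)) x,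
        Torus.timeDerivWithin S (fun s => Torus.partialDeriv i (Torus.laplacian^[n] (w s))) t x⟫)
      (x := t) (s := S) fun i _ => ((hDi i).hasDerivWithinAt_slice ht x).norm_sq
    have h2 := hsum.derivWithin (hU t ht)
    rw [Torus.timeDerivWithin, h2, Finset.mul_sum]
    refine Finset.sum_congr rfl fun i _ => ?_
    rw [Torus.timeDerivWithin_partialDeriv_comm hab hW ht i x, hcomm, real_inner_comm]
  -- Step 3: Green twice, `∑ᵢ ∫ ⟪∂ᵢΔⁿ∂ₜw, ∂ᵢΔⁿw⟫ = -∫ ⟪∂ₜw, Δ²ⁿ⁺¹w⟫`.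
  have hE' : 2⁻¹ * ∫ x, Torus.timeDerivWithin S
        (fun s x => ∑ i, ‖Torus.partialDeriv i (Torus.laplacian^[n] (w s)) x‖ ^ 2) t x =
      -∫ x, ⟪Torus.timeDerivWithin S w t x, (Torus.laplacian^[2 * n + 1] (w t)) x⟫ := by
    simp_rw [htd, integral_const_mul]
    rw [integral_finsetSum _ fun i _ => ((hnA.partialDeriv i).inner (hWt.partialDeriv i)).integrable,
      Torus.sum_integral_inner_partialDeriv_eq_neg_integral_inner_laplacian hnA hWt,
      Torus.integral_inner_laplacian_iterate_comm n hA hWt.laplacian, h2n1]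
    ring
  rw [hE'] at hE
  convert hE using 1
  -- Step 4: insert the equation; the pressure term drops out.
  have hA_eq : ∀ x, Torus.timeDerivWithin S w t x = ν • Torus.laplacian (w t) x -
      Torus.gradient (q t) x - (Torus.convect (u t) (w t) x + Torus.convect (w t) (u t) x) := by
    intro x
    rw [← hlin t ht x]
    abel
  have hF : Torus.IsSmooth (fun x => Torus.convect (u t) (w t) x + Torus.convect (w t) (u t) x) :=
    (hut.convect hwt).add (hwt.convect hut)
  have iL : Integrable (fun x => ⟪ν • Torus.laplacian (w t) x, (Torus.laplacian^[2 * n + 1] (w t)) x⟫) volume :=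
    ((hΔ.smul ν).inner hZ).integrable
  have iG : Integrable (fun x => ⟪Torus.gradient (q t) x, (Torus.laplacian^[2 * n + 1] (w t)) x⟫) volume :=
    (hqt.gradient.inner hZ).integrable
  have iF : Integrable (fun x => ⟪Torus.convect (u t) (w t) x + Torus.convect (w t) (u t) x,
      (Torus.laplacian^[2 * n + 1] (w t)) x⟫) volume := (hF.inner hZ).integrable
  have hsplit : ∫ x, ⟪Torus.timeDerivWithin S w t x, (Torus.laplacian^[2 * n + 1] (w t)) x⟫ =
      (∫ x, ⟪ν • Torus.laplacian (w t) x, (Torus.laplacian^[2 * n + 1] (w t)) x⟫) -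
        (∫ x, ⟪Torus.gradient (q t) x, (Torus.laplacian^[2 * n + 1] (w t)) x⟫) -
        ∫ x, ⟪Torus.convect (u t) (w t) x + Torus.convect (w t) (u t) x,
          (Torus.laplacian^[2 * n + 1] (w t)) x⟫ := by
    simp_rw [hA_eq, inner_sub_left]
    rw [integral_sub ?_ iF, integral_sub iL iG]
    exact iL.sub iG
  -- the viscous term: `ν ∫ ⟪Δw, Δ²ⁿ⁺¹w⟫ = ν ∫ ⟪Δⁿ(Δw), Δⁿ(Δw)⟫ = ν ‖Δⁿ⁺¹w‖₂²`
  have hvisc : ∫ x, ⟪ν • Torus.laplacian (w t) x, (Torus.laplacian^[2 * n + 1] (w t)) x⟫ =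
      ν * ∫ x, ‖(Torus.laplacian^[n + 1] (w t)) x‖ ^ 2 := by
    have hnΔ : Torus.IsSmooth (Torus.laplacian^[n] (Torus.laplacian (w t))) :=
      Torus.isSmooth_laplacian_iterate hΔ n
    have e1 : ∫ x, ⟪ν • Torus.laplacian (w t) x, (Torus.laplacian^[2 * n + 1] (w t)) x⟫ =
        ν * ∫ x, ⟪Torus.laplacian (w t) x,
          (Torus.laplacian^[n] (Torus.laplacian (Torus.laplacian^[n] (w t)))) x⟫ := by
      rw [← integral_const_mul, h2n1]
      refine integral_congr_ae (ae_of_all _ fun x => ?_)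
      simp only [real_inner_smul_left]
    have e2 : Torus.laplacian (Torus.laplacian^[n] (w t)) = Torus.laplacian^[n] (Torus.laplacian (w t)) := by
      rw [← Function.iterate_succ_apply' Torus.laplacian n, Function.iterate_succ_apply]
    rw [e1, e2, ← Torus.integral_inner_laplacian_iterate_comm n hΔ hnΔ, hn1]
    congr 1
    refine integral_congr_ae (ae_of_all _ fun x => ?_)
    simp only [real_inner_self_eq_norm_sq]
  have hpres : ∫ x, ⟪Torus.gradient (q t) x, (Torus.laplacian^[2 * n + 1] (w t)) x⟫ = 0 :=
    Torus.integral_inner_gradient_eq_zero_of_isDivFree hZ hqt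
      (Torus.IsDivFree.laplacian_iterate_of_isSmooth hwt (hwdiv t ht) (2 * n + 1))
  rw [hsplit, hvisc, hpres]
  ring

/-- **The `H³` balance of the linearised Navier–Stokes equation on the torus** (the case `n = 1` of
`Torus.linearisedNS_hasDerivWithinAt_half_gradNormSq_laplacian_iterate`, spelled without iterates):
`d/dt ½‖∇Δw(t)‖₂² = −ν ∫ ‖ΔΔw(t)‖² + ∫ ⟪(u·∇)w(t) + (w·∇)u(t), ΔΔΔw(t)⟫` within `[a, b]` — the first
variation equation paired with `A³U` (Constantin–Foias 1988, Ch. 14, (14.3), one level above the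
`A²U` pairing of the `H²` balance). [cite: FoiasManleyRosaTemam2001, App. II.A (A.55) and Ch. II §7] -/
theorem Torus.linearisedNS_hasDerivWithinAt_half_gradNormSq_laplacian
    {a b ν : ℝ} {u w : ℝ → UnitAddTorus d → EuclideanSpace ℝ d} {q : ℝ → UnitAddTorus d → ℝ}
    (hu : Torus.IsSmoothSpaceTimeOn (Icc a b) u) (hw : Torus.IsSmoothSpaceTimeOn (Icc a b) w)
    (hq : Torus.IsSmoothSpaceTimeOn (Icc a b) q) (hwdiv : ∀ t ∈ Icc a b, Torus.IsDivFree (w t))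
    (hlin : ∀ t ∈ Icc a b, ∀ x, Torus.timeDerivWithin (Icc a b) w t x +
      Torus.convect (u t) (w t) x + Torus.convect (w t) (u t) x =
        ν • Torus.laplacian (w t) x - Torus.gradient (q t) x)
    (hab : a < b) {t : ℝ} (ht : t ∈ Icc a b) :
    HasDerivWithinAt (fun s => 2⁻¹ * Torus.gradNormSq (Torus.laplacian (w s)))
      (-ν * (∫ x, ‖Torus.laplacian (Torus.laplacian (w t)) x‖ ^ 2) +
        ∫ x, ⟪Torus.convect (u t) (w t) x + Torus.convect (w t) (u t) x,
          Torus.laplacian (Torus.laplacian (Torus.laplacian (w t))) x⟫) (Icc a b) t :=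
  -- `Δ^[1] v = Δ v`, `Δ^[1 + 1] v = Δ (Δ v)` and `Δ^[2 * 1 + 1] v = Δ (Δ (Δ v))` hold by `rfl`
  Torus.linearisedNS_hasDerivWithinAt_half_gradNormSq_laplacian_iterate hu hw hq hwdiv hlin hab 1 ht

/-! ### The flux bound -/

/-- **Young for the `H³` flux, any dimension, production term symbolic.** For `ν > 0` and smooth
`F, w : T^d → ℝ^d`,
`−ν ∫ ‖ΔΔw‖² + ∫ ⟪F, ΔΔΔw⟫ ≤ −(ν/2) ∫ ‖ΔΔw‖² + ν⁻¹ ∫ ‖ΔF‖²`: move one Laplacian across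
(`∫ ⟪F, Δ(ΔΔw)⟫ = ∫ ⟪ΔF, ΔΔw⟫`, Green's second identity `Torus.integral_inner_laplacian_comm`) and use
`|∫ ⟪ΔF, ΔΔw⟫| ≤ ν⁻¹ ∫ ‖ΔF‖² + (ν/4) ∫ ‖ΔΔw‖²` (`Torus.abs_integral_inner_le_integral_norm_sq` with
`ε = 2ν⁻¹`); half of the dissipation survives. [folklore] -/
theorem Torus.neg_mul_integral_norm_laplacian_laplacian_sq_add_le {ν : ℝ} (hν : 0 < ν)
    {F w : UnitAddTorus d → EuclideanSpace ℝ d} (hF : Torus.IsSmooth F) (hw : Torus.IsSmooth w) :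
    -ν * (∫ x, ‖Torus.laplacian (Torus.laplacian w) x‖ ^ 2) +
        ∫ x, ⟪F x, Torus.laplacian (Torus.laplacian (Torus.laplacian w)) x⟫ ≤
      -(ν / 2) * (∫ x, ‖Torus.laplacian (Torus.laplacian w) x‖ ^ 2) +
        ν⁻¹ * ∫ x, ‖Torus.laplacian F x‖ ^ 2 := by
  have hΔΔ : Torus.IsSmooth (Torus.laplacian (Torus.laplacian w)) := hw.laplacian.laplacian
  rw [← Torus.integral_inner_laplacian_comm hF hΔΔ]
  have hε : 0 < 2 * ν⁻¹ := by positivity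
  have h1 := Torus.abs_integral_inner_le_integral_norm_sq hF.laplacian hΔΔ hε
  have hc1 : 2 * ν⁻¹ / 2 = ν⁻¹ := by ring
  have hc2 : (2 * (2 * ν⁻¹))⁻¹ = ν / 4 := by
    rw [mul_inv, mul_inv, inv_inv]; ring
  rw [hc1, hc2] at h1
  have h1' := (le_abs_self _).trans h1
  have hW : 0 ≤ ν * ∫ x, ‖Torus.laplacian (Torus.laplacian w) x‖ ^ 2 :=
    mul_nonneg hν.le (integral_nonneg fun x => sq_nonneg _)
  linarith

/-- **Flux bound of the `H³` balance of the linearised equation on `T³`** (`ν > 0`, zero-mean `w`).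
On `T^d` with `card d = 3` there is `C ≥ 0` such that for every `ν > 0`, all smooth
`v, w : T^d → ℝ^d` with `∫ w = 0`, `‖v‖ ≤ M`, `‖∂ₖv‖ ≤ L`, and `F = (v·∇)w + (w·∇)v`,
`−ν‖ΔΔw‖₂² + ∫ ⟪F, ΔΔΔw⟫ ≤ −(ν/2)‖ΔΔw‖₂² + ν⁻¹ C (M² + L² + ‖Δv‖₂² + ‖∇Δv‖₂²)(‖∇w‖₂² + ‖Δw‖₂² + ‖∇Δw‖₂²)`
(`Torus.neg_mul_integral_norm_laplacian_laplacian_sq_add_le` and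
`Torus.integral_norm_laplacian_convect_add_convect_sq_le`) — the linearised form of the `k = 3`
differential inequality (7.3) of Robinson–Rodrigo–Sadowski 2016, LINEAR in the top-order quantity
`‖∇Δw‖₂²` once `v` is controlled in `W^{1,∞} ∩ H³`. [folklore] -/
theorem Torus.linearisedNS_gradNormSq_laplacian_flux_le (hd : Fintype.card d = 3) :
    ∃ C : ℝ, 0 ≤ C ∧ ∀ {ν : ℝ}, 0 < ν → ∀ {v w : UnitAddTorus d → EuclideanSpace ℝ d},
      Torus.IsSmooth v → Torus.IsSmooth w → Torus.HasZeroMean w →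
      ∀ {M L : ℝ}, (∀ x, ‖v x‖ ≤ M) → (∀ (k : d) (x : UnitAddTorus d), ‖Torus.partialDeriv k v x‖ ≤ L) →
        -ν * (∫ x, ‖Torus.laplacian (Torus.laplacian w) x‖ ^ 2) +
            ∫ x, ⟪Torus.convect v w x + Torus.convect w v x,
              Torus.laplacian (Torus.laplacian (Torus.laplacian w)) x⟫ ≤
          -(ν / 2) * (∫ x, ‖Torus.laplacian (Torus.laplacian w) x‖ ^ 2) +
            ν⁻¹ * (C * (M ^ 2 + L ^ 2 + (∫ x, ‖Torus.laplacian v x‖ ^ 2) + Torus.gradNormSq (Torus.laplacian v)) *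
              (Torus.gradNormSq w + (∫ x, ‖Torus.laplacian w x‖ ^ 2) + Torus.gradNormSq (Torus.laplacian w))) := by
  obtain ⟨C, hC0, hC⟩ := Torus.integral_norm_laplacian_convect_add_convect_sq_le (d := d) hd
  refine ⟨C, hC0, fun {ν} hν {v w} hv hw h0 {M L} hM hL => ?_⟩
  have hF : Torus.IsSmooth (fun y => Torus.convect v w y + Torus.convect w v y) :=
    (hv.convect hw).add (hw.convect hv)
  have h1 := Torus.neg_mul_integral_norm_laplacian_laplacian_sq_add_le hν hF hw
  have h2 := mul_le_mul_of_nonneg_left (hC hv hw h0 hM hL) (inv_pos.2 hν).le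
  exact h1.trans (by linarith)

end Literature.Analysis.FluidPDE

end
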